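import Summits.QuantumAdvantage.QuantumAdvantage.Theorems.LinnikCubicClassGroupsDegreeOnePrimesEscapeCyclotomicLinnik
import Summits.QuantumAdvantage.QuantumAdvantage.Theorems.LinnikCubicClassGroupsDegreeOnePrimesEscapeRayClassPi
import Summits.QuantumAdvantage.QuantumAdvantage.Theorems.LinnikCubicClassGroupsDegreeOnePrimesEscapeRayClassShortInterval
import Literature.NumberTheory.LFunctions.LogIntegralStrictMonoProofs
import HarnessLib

/-!
# Linnik's theorem for cosets of a congruence class group, XIII: prime ideals with norm in a prescribed residue
# class `mod m` — Brun–Titchmarsh in the Linnik range and short intervals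

Topic `Summits/QuantumAdvantage/QuantumAdvantage/Theorems`, cell B2b-1 (linnik-cubic), PART A (gen 25); helper toward
the crux `DegreeOnePrimesEscape` (stmt-QuantumAdvantage-11543) of route `LinnikCubicClassGroups`.  HONEST FRAMING: the
value of this file is a THEOREM (kernel-checked, GRH-free, Siegel-free) — NOT summit progress (the route still rests on
the hypothesis-type target `PureCubicClassNumberHard`).

The cyclotomic Frobenius datum of file XII (`frobChar`, `H = χ_m(Gal(K(ζ_m)/K))`, modulus `(m)`,
`Q_{(m)} ≤ (|d_K| m)^{n²+1}`) fed into the coset prime number theorem in `π`-form (file IX, `fiberPrimeCount_relative`)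
and the Hoheisel–Linnik theorem for cosets (file XI, `exists_prime_fiber_absNorm_mem_Ioc`).  For `K` of degree
`n > 1`, `m ≥ 1`, `N = K(ζ_m)`:
* `cyclotomic_primeCount_le` — **Brun–Titchmarsh for Frobenius classes of `K(ζ_m)/K` in the Linnik range**:
  `#{𝔭 ∌ m : Frob_𝔭 = σ, N𝔭 ≤ x} ≤ (2+ε) Li(x)/[N:K]` for all `x ≥ (|d_K| m)^{L(n,ε)}` (the factor `2` is the price
  of a possible exceptional zero, as in the classical Brun–Titchmarsh theorem);
* `primeCount_absNorm_modEq_le` — the same for **the prime ideals with `N𝔭 ≡ a (mod m)`**, any `a`: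
  `#{𝔭 ∌ m : N𝔭 ≡ a (mod m), N𝔭 ≤ x} ≤ (2+ε) Li(x)/[K(ζ_m):K]`;
* `exists_prime_frobenius_eq_mem_Ioc_of_isCyclotomicExtension` — **every `σ ∈ Gal(K(ζ_m)/K)` is the Frobenius of a
  prime `𝔭 ∌ m` with `x < N𝔭 ≤ x + h`**, for all `x ≥ (|d_K| m)^L`, `x^{1-δ} ≤ h ≤ x` (`δ = δ(n)`, `L = L(n)`);
* `exists_prime_absNorm_modEq_mem_Ioc` — **prime ideals with `N𝔭 ≡ N𝔞 (mod m)` in every short interval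
  `(x, x+h]`** as above, for every ideal `𝔞` prime to `m` (a statement about `K` alone).
In print: K-uniform ray-class versions are Weiss 1983 §6 (least prime / Brun–Titchmarsh shape) and, for short
intervals with a fixed field, Balog–Ono 2001; ours are kernel-checked with inexplicit `L(n), δ(n)`.
References: [Weiss1983] Thm 6.4, §6; [ThornerZaman2017] Thm 3.1; [LagariasMontgomeryOdlyzko1979] Thm 1.1;
[TateGCFT1967] Ch. VII §3.4.
-/

noncomputable section

open Complex Real Set Filter Topology NumberField IsDedekindDomain
open scoped NumberField nonZeroDivisors

namespace Summit.QuantumAdvantage.QuantumAdvantage.Theorems.DegreeOnePrimesEscape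

open Literature.NumberTheory.LFunctions Literature.NumberTheory.LFunctions.NumberField
  Literature.NumberTheory.LFunctions.AbelianDensity Literature.NumberTheory.GaloisRepresentations
open scoped Classical

section Dictionary

variable {K : Type} [Field K] [NumberField K] {N : Type} [Field N] [NumberField N] [Algebra K N]
  (m : ℕ) [NeZero m] [IsCyclotomicExtension {m} K N]

/-- `|H| = [K(ζ_m) : K]`. -/
theorem natCard_range_cycloChar_eq_finrank :
    Nat.card (cycloChar K N m).range = Module.finrank K N := by
  haveI := isGalois_of_isCyclotomicExtension K N m
  haveI : FiniteDimensional K N := Module.Finite.of_restrictScalars_finite ℚ K N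
  rw [← IsGalois.card_aut_eq_finrank,
    Nat.card_congr (MonoidHom.ofInjective (cycloChar_injective K N m)).toEquiv.symm]

/-- The fibre of `frobChar` over `χ_m|^H(σ)` off `(m)` is the set of primes `𝔭 ∌ m` with `Frob_𝔭 = σ`. -/
theorem frobChar_eq_rangeRestrict_iff (σ : haveI := isGalois_of_isCyclotomicExtension K N m; N ≃ₐ[K] N)
    (v : HeightOneSpectrum (𝓞 K)) :
    haveI := isGalois_of_isCyclotomicExtension K N m
    frobChar K N m v = (cycloChar K N m).rangeRestrict σ ↔ galFrob K N v = σ := by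
  haveI := isGalois_of_isCyclotomicExtension K N m
  rw [frobChar_eq_rangeRestrict]
  constructor
  · intro h
    apply cycloChar_injective K N m
    have := congrArg (fun x : (cycloChar K N m).range ↦ (x : (ZMod m)ˣ)) h
    simpa only [MonoidHom.coe_rangeRestrict] using this
  · intro h; rw [h]

/-- For `𝔭 ∌ m`: `N𝔭 ≡ a (mod m)` iff `χ_m(Frob_𝔭) = a`. -/
theorem natCast_absNorm_eq_iff {v : HeightOneSpectrum (𝓞 K)} (hm : (m : 𝓞 K) ∉ v.asIdeal) (a : ℕ) :
    haveI := isGalois_of_isCyclotomicExtension K N m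
    Ideal.absNorm v.asIdeal ≡ a [MOD m] ↔ ((cycloChar K N m (galFrob K N v) : (ZMod m)ˣ) : ZMod m) = a := by
  rw [val_cycloChar_galFrob K N m v hm, ← ZMod.natCast_eq_natCast_iff]

omit [NumberField K] [NeZero m] [IsCyclotomicExtension {m} K N] in
/-- `¬ (m) ≤ 𝔭 ↔ m ∉ 𝔭`. -/
theorem not_span_le_iff (v : HeightOneSpectrum (𝓞 K)) :
    ¬ Ideal.span {(m : 𝓞 K)} ≤ v.asIdeal ↔ (m : 𝓞 K) ∉ v.asIdeal := by
  rw [Ideal.span_singleton_le_iff_mem]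

end Dictionary

/-! ### Brun–Titchmarsh in the Linnik range -/

/-- `Li(x) − θ Li(x^β) ≤ 2 Li(x)` for `|θ| ≤ 1`, `3/4 ≤ β < 1`, `x ≥ 3` (`0 ≤ Li(x^β) ≤ Li(x)`). -/
theorem offsetLogIntegral_sub_mul_le_two_mul {x β θ : ℝ} (hx : 3 ≤ x) (hβ : 3 / 4 ≤ β) (hβ1 : β ≤ 1)
    (hθ : |θ| ≤ 1) :
    offsetLogIntegral x - θ * offsetLogIntegral (x ^ β) ≤ 2 * offsetLogIntegral x := by
  have hx1 : (1 : ℝ) < x := by linarith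
  have hxβ2 : (2 : ℝ) ≤ x ^ β := by
    have h9 : (3 : ℝ) ^ ((3 : ℝ) / 4) ≤ x ^ β :=
      (Real.rpow_le_rpow (by norm_num) hx (by norm_num)).trans (Real.rpow_le_rpow_of_exponent_le hx1.le hβ)
    have h8 : (2 : ℝ) ≤ (3 : ℝ) ^ ((3 : ℝ) / 4) := by
      have h16 : ((2 : ℝ) ^ (4 : ℕ) : ℝ) ≤ (3 : ℝ) ^ (3 : ℕ) := by norm_num
      have : ((2 : ℝ) ^ (4 : ℝ)) ^ ((1 : ℝ) / 4) ≤ ((3 : ℝ) ^ (3 : ℝ)) ^ ((1 : ℝ) / 4) := by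
        apply Real.rpow_le_rpow (by positivity) _ (by norm_num)
        rw [show (4 : ℝ) = ((4 : ℕ) : ℝ) by norm_num, show (3 : ℝ) = ((3 : ℕ) : ℝ) by norm_num,
          Real.rpow_natCast, Real.rpow_natCast]
        exact_mod_cast h16
      rw [← Real.rpow_mul (by norm_num), ← Real.rpow_mul (by norm_num)] at this
      norm_num at this
      exact this
    linarith
  have hxβx : x ^ β ≤ x := by
    have := Real.rpow_le_rpow_of_exponent_le hx1.le hβ1
    rwa [Real.rpow_one] at this
  have hLi0 : 0 ≤ offsetLogIntegral (x ^ β) := by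
    rw [offsetLogIntegral]
    exact intervalIntegral.integral_nonneg hxβ2 fun t ht => by
      have : 1 < t := by linarith [ht.1]
      exact inv_nonneg.mpr (Real.log_nonneg this.le)
  have hLimono : offsetLogIntegral (x ^ β) ≤ offsetLogIntegral x :=
    strictMonoOn_offsetLogIntegral_holds.monotoneOn (by rw [Set.mem_Ioi]; linarith)
      (by rw [Set.mem_Ioi]; linarith) hxβx
  have hθ1 := (abs_le.mp hθ).1
  nlinarith [mul_nonneg (by linarith : 0 ≤ θ + 1) hLi0]

/-- **Brun–Titchmarsh for the Frobenius classes of `K(ζ_m)/K` in the Linnik range** (see the module docstring): for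
`n > 1`, `ε > 0` there is `L = L(n, ε) > 0` such that for every number field `K` of degree `n`, every `m ≥ 1`, every
`N = K(ζ_m)`, every `σ ∈ Gal(N/K)` and every `x ≥ (|d_K| m)^L`:
`#{𝔭 ∌ m : Frob_𝔭 = σ, N𝔭 ≤ x} ≤ (2 + ε) Li(x) / [N:K]`. [cite: Weiss1983, §6] [cite: ThornerZaman2017, Theorem 3.1] -/
theorem cyclotomic_primeCount_le (n : ℕ) (hn : 1 < n) {ε : ℝ} (hε : 0 < ε) :
    ∃ L : ℝ, 0 < L ∧ ∀ (K : Type) [Field K] [NumberField K], Module.finrank ℚ K = n →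
    ∀ (m : ℕ) [NeZero m] (N : Type) [Field N] [NumberField N] [Algebra K N] [IsCyclotomicExtension {m} K N],
      haveI := isGalois_of_isCyclotomicExtension K N m
      ∀ x : ℝ, (|(NumberField.discr K : ℝ)| * m) ^ L ≤ x → ∀ σ : N ≃ₐ[K] N,
        (({v : HeightOneSpectrum (𝓞 K) | (m : 𝓞 K) ∉ v.asIdeal ∧ galFrob K N v = σ ∧
            (Ideal.absNorm v.asIdeal : ℝ) ≤ x}.ncard : ℕ) : ℝ) ≤
          (2 + ε) * offsetLogIntegral x / Module.finrank K N := by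
  have hε2 : 0 < ε / 2 := by positivity
  obtain ⟨L, c, hL1, hc, hcn, hPNT⟩ := fiberPrimeCount_relative n hn hε2
  refine ⟨((n ^ 2 + 1 : ℕ) : ℝ) * L, by positivity, fun K _ _ hKn m _ N _ _ _ _ x hx σ ↦ ?_⟩
  haveI := isGalois_of_isCyclotomicExtension K N m
  have hK : 1 < Module.finrank ℚ K := by rw [hKn]; exact hn
  set 𝔪 : Ideal (𝓞 K) := Ideal.span {(m : 𝓞 K)} with h𝔪def
  have h𝔪 : 𝔪 ≠ ⊥ := span_natCast_ne_bot m
  have hR12 : (12 : ℝ) ≤ rayCondQ K 𝔪 := twelve_le_rayCondQ hK h𝔪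
  have hxR : rayCondQ K 𝔪 ^ L ≤ x := by
    have := rayCondQ_span_natCast_rpow_le (K := K) m hK (by linarith : (0 : ℝ) ≤ L)
    rw [hKn] at this
    exact this.trans hx
  have hx3 : (3 : ℝ) ≤ x := by
    refine le_trans ?_ hxR
    have := Real.rpow_le_rpow_of_exponent_le (by linarith : (1 : ℝ) ≤ rayCondQ K 𝔪) hL1
    rw [Real.rpow_one] at this
    linarith
  have hLi0 : 0 ≤ offsetLogIntegral x := by
    rw [offsetLogIntegral]
    exact intervalIntegral.integral_nonneg (by linarith) fun t ht => by
      have : 1 < t := by linarith [ht.1]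
      exact inv_nonneg.mpr (Real.log_nonneg this.le)
  -- the set in the statement is the fibre of the datum over `χ_m|^H(σ)`
  have hset : {v : HeightOneSpectrum (𝓞 K) | (m : 𝓞 K) ∉ v.asIdeal ∧ galFrob K N v = σ ∧
      (Ideal.absNorm v.asIdeal : ℝ) ≤ x} =
      {v : HeightOneSpectrum (𝓞 K) | ¬ 𝔪 ≤ v.asIdeal ∧ frobChar K N m v = (cycloChar K N m).rangeRestrict σ ∧
        (Ideal.absNorm v.asIdeal : ℝ) ≤ x} := by
    ext v
    simp only [Set.mem_setOf_eq, h𝔪def, not_span_le_iff, frobChar_eq_rangeRestrict_iff]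
  have hcard : (Nat.card (cycloChar K N m).range : ℝ) = Module.finrank K N := by
    rw [natCard_range_cycloChar_eq_finrank]
  have hG0 : (0 : ℝ) < Nat.card (cycloChar K N m).range := by
    haveI : Finite (cycloChar K N m).range := inferInstance
    exact_mod_cast Nat.card_pos
  rw [hset, ← hcard]
  set τ := (cycloChar K N m).rangeRestrict σ
  rcases hPNT K hKn (cycloChar K N m).range 𝔪 (frobChar K N m) h𝔪 (artinKillsRay_frobChar K N m le_rfl)
      (fun χ hχ ↦ frobChar_nonprincipal m h𝔪 χ hχ) (natCard_range_cycloChar_le m hK) with hA | hB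
  · have h1 := (abs_le.mp (hA x hxR τ)).2
    have h2 : offsetLogIntegral x / Nat.card (cycloChar K N m).range + ε / 2 * offsetLogIntegral x /
        Nat.card (cycloChar K N m).range ≤ (2 + ε) * offsetLogIntegral x / Nat.card (cycloChar K N m).range := by
      have e : offsetLogIntegral x / Nat.card (cycloChar K N m).range + ε / 2 * offsetLogIntegral x /
          Nat.card (cycloChar K N m).range = (1 + ε / 2) * offsetLogIntegral x / Nat.card (cycloChar K N m).range := by
        ring
      rw [e, div_le_div_iff_of_pos_right hG0]
      nlinarith
    linarith
  · obtain ⟨ψ₁, β₁, -, hβ₁, hβ₁1, -, hmain⟩ := hB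
    obtain ⟨hpos, hb⟩ := hmain x hxR τ
    have h1 := (abs_le.mp hb).2
    -- `β₁ ≥ 3/4` from the window (`c ≤ 1/(8(n²+1)) ≤ 1/4`, `log(|d_K| N𝔪) + log 4 ≥ 3`)
    have hβ34 : 3 / 4 ≤ β₁ := by
      have hc4 : c ≤ 1 / 4 := hcn.trans
        (one_div_le_one_div_of_le (by norm_num) (by nlinarith [sq_nonneg (n : ℝ)]))
      have hd3 : 3 ≤ ((NumberField.discr K).natAbs : ℝ) * ((Ideal.absNorm 𝔪 : ℕ) : ℝ) := by
        have hN1 : (1 : ℝ) ≤ ((Ideal.absNorm 𝔪 : ℕ) : ℝ) := one_le_absNorm_cast h𝔪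
        have hD3 : (3 : ℝ) ≤ ((NumberField.discr K).natAbs : ℝ) := by
          have h := NumberField.abs_discr_gt_two hK
          have h3 : (3 : ℤ) ≤ ((NumberField.discr K).natAbs : ℤ) := by
            rw [Int.natCast_natAbs]; exact Int.add_one_le_iff.mpr h
          exact_mod_cast h3
        nlinarith
      exact three_quarters_le_of_window hc hc4 hd3 hβ₁
    have hθ : |(ψ₁ (Additive.ofMul τ)).re| ≤ 1 :=
      (Complex.abs_re_le_norm _).trans (by rw [AddChar.norm_apply])
    have h2 := offsetLogIntegral_sub_mul_le_two_mul hx3 hβ34 hβ₁1.le hθ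
    have h3 : (1 + ε / 2) * (offsetLogIntegral x - (ψ₁ (Additive.ofMul τ)).re * offsetLogIntegral (x ^ β₁)) /
        Nat.card (cycloChar K N m).range ≤ (2 + ε) * offsetLogIntegral x / Nat.card (cycloChar K N m).range := by
      rw [div_le_div_iff_of_pos_right hG0]
      have h4 : (1 + ε / 2) * (offsetLogIntegral x - (ψ₁ (Additive.ofMul τ)).re * offsetLogIntegral (x ^ β₁)) ≤
          (1 + ε / 2) * (2 * offsetLogIntegral x) := mul_le_mul_of_nonneg_left h2 (by positivity)
      nlinarith
    have h5 : (offsetLogIntegral x - (ψ₁ (Additive.ofMul τ)).re * offsetLogIntegral (x ^ β₁)) /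
        Nat.card (cycloChar K N m).range +
        ε / 2 * (offsetLogIntegral x - (ψ₁ (Additive.ofMul τ)).re * offsetLogIntegral (x ^ β₁)) /
        Nat.card (cycloChar K N m).range =
        (1 + ε / 2) * (offsetLogIntegral x - (ψ₁ (Additive.ofMul τ)).re * offsetLogIntegral (x ^ β₁)) /
        Nat.card (cycloChar K N m).range := by ring
    linarith

/-- **Brun–Titchmarsh for the prime ideals with `N𝔭 ≡ a (mod m)` in the Linnik range**: for `n > 1`, `ε > 0` there
is `L = L(n, ε) > 0` such that for every number field `K` of degree `n`, every `m ≥ 1`, every `a` and every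
`x ≥ (|d_K| m)^L`: `#{𝔭 ∌ m : N𝔭 ≡ a (mod m), N𝔭 ≤ x} ≤ (2 + ε) Li(x) / [K(ζ_m):K]`.
[cite: Weiss1983, §6] [cite: ThornerZaman2017, Theorem 3.1] -/
theorem primeCount_absNorm_modEq_le (n : ℕ) (hn : 1 < n) {ε : ℝ} (hε : 0 < ε) :
    ∃ L : ℝ, 0 < L ∧ ∀ (K : Type) [Field K] [NumberField K], Module.finrank ℚ K = n →
    ∀ (m : ℕ) [NeZero m], ∀ a : ℕ, ∀ x : ℝ, (|(NumberField.discr K : ℝ)| * m) ^ L ≤ x →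
      (({v : HeightOneSpectrum (𝓞 K) | (m : 𝓞 K) ∉ v.asIdeal ∧ Ideal.absNorm v.asIdeal ≡ a [MOD m] ∧
          (Ideal.absNorm v.asIdeal : ℝ) ≤ x}.ncard : ℕ) : ℝ) ≤
        (2 + ε) * offsetLogIntegral x / Module.finrank K (CyclotomicField m K) := by
  obtain ⟨L, hL, h⟩ := cyclotomic_primeCount_le n hn hε
  refine ⟨max L 1, by positivity, fun K _ _ hKn m _ a x hx ↦ ?_⟩
  set N : Type := CyclotomicField m K
  haveI := isGalois_of_isCyclotomicExtension K N m
  have hK : 1 < Module.finrank ℚ K := by rw [hKn]; exact hn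
  have hb2 : (2 : ℝ) ≤ |(NumberField.discr K : ℝ)| * m := by
    have hD2 : 2 < |(NumberField.discr K : ℝ)| := by
      have h := NumberField.abs_discr_gt_two hK
      rw [← Int.cast_abs]; exact_mod_cast h
    have hm1 : (1 : ℝ) ≤ m := by exact_mod_cast NeZero.one_le
    nlinarith
  have hb1 : (1 : ℝ) ≤ |(NumberField.discr K : ℝ)| * m := by linarith
  have hxL : (|(NumberField.discr K : ℝ)| * m) ^ L ≤ x :=
    (Real.rpow_le_rpow_of_exponent_le hb1 (le_max_left L 1)).trans hx
  have hx2 : (2 : ℝ) ≤ x := by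
    have := Real.rpow_le_rpow_of_exponent_le hb1 (le_max_right L 1)
    rw [Real.rpow_one] at this
    exact hb2.trans (this.trans hx)
  by_cases ha : ∃ σ : N ≃ₐ[K] N, ((cycloChar K N m σ : (ZMod m)ˣ) : ZMod m) = a
  · obtain ⟨σ, hσ⟩ := ha
    have hset : {v : HeightOneSpectrum (𝓞 K) | (m : 𝓞 K) ∉ v.asIdeal ∧ Ideal.absNorm v.asIdeal ≡ a [MOD m] ∧
        (Ideal.absNorm v.asIdeal : ℝ) ≤ x} =
        {v : HeightOneSpectrum (𝓞 K) | (m : 𝓞 K) ∉ v.asIdeal ∧ galFrob K N v = σ ∧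
          (Ideal.absNorm v.asIdeal : ℝ) ≤ x} := by
      ext v
      simp only [Set.mem_setOf_eq]
      constructor
      · rintro ⟨hm, hres, hle⟩
        refine ⟨hm, ?_, hle⟩
        apply cycloChar_injective K N m
        apply Units.ext
        rw [hσ]; exact (natCast_absNorm_eq_iff (N := N) m hm a).mp hres
      · rintro ⟨hm, hF, hle⟩
        refine ⟨hm, ?_, hle⟩
        rw [natCast_absNorm_eq_iff (N := N) m hm a, hF, hσ]
    rw [hset]
    exact h K hKn m N x hxL σ
  · -- no prime `𝔭 ∌ m` has `N𝔭 ≡ a (mod m)`: the set is empty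
    have hset : {v : HeightOneSpectrum (𝓞 K) | (m : 𝓞 K) ∉ v.asIdeal ∧ Ideal.absNorm v.asIdeal ≡ a [MOD m] ∧
        (Ideal.absNorm v.asIdeal : ℝ) ≤ x} = ∅ := by
      ext v
      simp only [Set.mem_setOf_eq, Set.mem_empty_iff_false, iff_false, not_and]
      intro hm hres _
      exact ha ⟨galFrob K N v, (natCast_absNorm_eq_iff (N := N) m hm a).mp hres⟩
    rw [hset, Set.ncard_empty, Nat.cast_zero]
    have hLi0 : 0 ≤ offsetLogIntegral x := by
      rw [offsetLogIntegral]
      exact intervalIntegral.integral_nonneg hx2 fun t ht => by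
        have : 1 < t := by linarith [ht.1]
        exact inv_nonneg.mpr (Real.log_nonneg this.le)
    positivity

/-! ### Short intervals -/

/-- **Hoheisel–Linnik for the Frobenius classes of `K(ζ_m)/K`** (see the module docstring): for `n > 1` there are
`δ = δ(n) > 0`, `L = L(n) > 0` such that for every number field `K` of degree `n`, every `m ≥ 1`, every `N = K(ζ_m)`,
every `x ≥ (|d_K| m)^L`, every `h` with `x^{1-δ} ≤ h ≤ x` and every `σ ∈ Gal(N/K)` there is a prime `𝔭 ∌ m` of `K`,
unramified in `N`, with `x < N𝔭 ≤ x + h`, all of whose Frobenii equal `σ`.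
[cite: LagariasMontgomeryOdlyzko1979, Theorem 1.1] [cite: Weiss1983, §6] -/
theorem exists_prime_frobenius_eq_mem_Ioc_of_isCyclotomicExtension (n : ℕ) (hn : 1 < n) :
    ∃ δ L : ℝ, 0 < δ ∧ 0 < L ∧ ∀ (K : Type) [Field K] [NumberField K], Module.finrank ℚ K = n →
    ∀ (m : ℕ) [NeZero m] (N : Type) [Field N] [NumberField N] [Algebra K N] [IsCyclotomicExtension {m} K N],
      ∀ x h : ℝ, (|(NumberField.discr K : ℝ)| * m) ^ L ≤ x → x ^ (1 - δ) ≤ h → h ≤ x →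
      ∀ σ : N ≃ₐ[K] N, ∃ v : HeightOneSpectrum (𝓞 K), (m : 𝓞 K) ∉ v.asIdeal ∧
        Algebra.IsUnramifiedIn (𝓞 N) v.asIdeal ∧
        x < (Ideal.absNorm v.asIdeal : ℝ) ∧ (Ideal.absNorm v.asIdeal : ℝ) ≤ x + h ∧
        ((Ideal.absNorm v.asIdeal : ℕ) : ZMod m) = ((cycloChar K N m σ : (ZMod m)ˣ) : ZMod m) ∧
        ∀ Q ∈ v.asIdeal.primesOver (𝓞 N), ∀ φ : N ≃ₐ[K] N, IsArithFrobAt (𝓞 K) φ Q → φ = σ := by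
  obtain ⟨δ, L, hδ, hL, hF⟩ := exists_prime_fiber_absNorm_mem_Ioc n hn
  refine ⟨δ, ((n ^ 2 + 1 : ℕ) : ℝ) * L, hδ, by positivity, fun K _ _ hKn m _ N _ _ _ _ x h hx hhx hhx' σ ↦ ?_⟩
  haveI := isGalois_of_isCyclotomicExtension K N m
  have hcomm := gal_commute_of_isCyclotomicExtension K N m
  have hK : 1 < Module.finrank ℚ K := by rw [hKn]; exact hn
  set 𝔪 : Ideal (𝓞 K) := Ideal.span {(m : 𝓞 K)} with h𝔪def
  have h𝔪 : 𝔪 ≠ ⊥ := span_natCast_ne_bot m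
  have hxR : rayCondQ K 𝔪 ^ L ≤ x := by
    have := rayCondQ_span_natCast_rpow_le (K := K) m hK hL.le
    rw [hKn] at this
    exact this.trans hx
  obtain ⟨v, hmv, hfv, hlo, hhi⟩ := hF K hKn (cycloChar K N m).range 𝔪 (frobChar K N m) h𝔪
    (artinKillsRay_frobChar K N m le_rfl) (fun χ hχ ↦ frobChar_nonprincipal m h𝔪 χ hχ)
    (natCard_range_cycloChar_le m hK) x h hxR hhx hhx' ((cycloChar K N m).rangeRestrict σ)
  have hm : (m : 𝓞 K) ∉ v.asIdeal := by rwa [h𝔪def, Ideal.span_singleton_le_iff_mem] at hmv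
  have hunr : Algebra.IsUnramifiedIn (𝓞 N) v.asIdeal := isUnramifiedIn_of_natCast_not_mem m hm
  have hFrob : galFrob K N v = σ := (frobChar_eq_rangeRestrict_iff m σ v).mp hfv
  refine ⟨v, hm, hunr, hlo, hhi, ?_, fun Q hQ φ hφ ↦ (eq_galFrob hcomm hunr hQ hφ).trans hFrob⟩
  rw [← hFrob]
  exact (val_cycloChar_galFrob K N m v hm).symm

/-- **Prime ideals with norm in a prescribed residue class `mod m` in short intervals**: for `n > 1` there are
`δ = δ(n) > 0`, `L = L(n) > 0` such that for every number field `K` of degree `n`, every `m ≥ 1`, every nonzero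
ideal `𝔞` of `𝓞 K` coprime to `(m)`, every `x ≥ (|d_K| m)^L` and `x^{1-δ} ≤ h ≤ x` there is a prime `𝔭 ∌ m` with
`N𝔭 ≡ N𝔞 (mod m)` and `x < N𝔭 ≤ x + h`. [cite: LagariasMontgomeryOdlyzko1979, Theorem 1.1] [cite: Weiss1983, §6] -/
theorem exists_prime_absNorm_modEq_mem_Ioc (n : ℕ) (hn : 1 < n) :
    ∃ δ L : ℝ, 0 < δ ∧ 0 < L ∧ ∀ (K : Type) [Field K] [NumberField K], Module.finrank ℚ K = n →
    ∀ m : ℕ, m ≠ 0 → ∀ I : Ideal (𝓞 K), I ≠ ⊥ → IsCoprime I (Ideal.span {(m : 𝓞 K)}) →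
      ∀ x h : ℝ, (|(NumberField.discr K : ℝ)| * m) ^ L ≤ x → x ^ (1 - δ) ≤ h → h ≤ x →
      ∃ v : HeightOneSpectrum (𝓞 K), (m : 𝓞 K) ∉ v.asIdeal ∧
        Ideal.absNorm v.asIdeal ≡ Ideal.absNorm I [MOD m] ∧
        x < (Ideal.absNorm v.asIdeal : ℝ) ∧ (Ideal.absNorm v.asIdeal : ℝ) ≤ x + h := by
  obtain ⟨δ, L, hδ, hL, h⟩ := exists_prime_frobenius_eq_mem_Ioc_of_isCyclotomicExtension n hn
  refine ⟨δ, L, hδ, hL, fun K _ _ hKn m hm0 I hI hcop x h' hx hhx hhx' ↦ ?_⟩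
  haveI : NeZero m := ⟨hm0⟩
  set N : Type := CyclotomicField m K
  haveI := isGalois_of_isCyclotomicExtension K N m
  set σ₀ : (cycloChar K N m).range := artinSymbol (frobChar K N m) I with hσ₀
  have hσ₀val : ((σ₀ : (ZMod m)ˣ) : ZMod m) = (Ideal.absNorm I : ZMod m) :=
    val_artinSymbol_frobChar K N m hI (natCast_not_mem_of_dvd_of_isCoprime m hcop)
  obtain ⟨τ, hτ⟩ := σ₀.2
  obtain ⟨v, hm, -, hlo, hhi, hres, -⟩ := h K hKn m N x h' hx hhx hhx' τ
  refine ⟨v, hm, ?_, hlo, hhi⟩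
  rw [hτ, hσ₀val] at hres
  exact (ZMod.natCast_eq_natCast_iff _ _ _).mp hres

end Summit.QuantumAdvantage.QuantumAdvantage.Theorems.DegreeOnePrimesEscape

end
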